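import Mathlib
import Literature.Analysis.PDE.RindlerModePacket
import Literature.Geometry.Lorentzian.ReggeWheelerHorizonMass
import HarnessLib

/-!
# The Rindler rest packet against the Regge–Wheeler (Maxwell) potential: defect, support and data

Literature support file (everything proved, no definitions), combining
`Literature/Analysis/PDE/RindlerModePacket.lean` (the explicit `k = 0` Rindler mode with a Kruskal
cut-off, an exact solution of `ψ_tt − ψ_xx + μ² e^{2κ(x−x_e)} ψ = 0` up to the cut-off commutator)
with `ReggeWheelerHorizonMass.lean` (`V_{1,ℓ}(r(x)) = ℓ(ℓ+1) w₀ e^{(x−x_c)/2M}(1 + O(e^{(x−x_c)/2M}))`).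
With the surface gravity `κ = 1/4M`, the near edge `x_e = x_c − ρ`, `η = e^{κ(x_e − x_c)}` and the
horizon-regular mass `μ² = ℓ(ℓ+1) w₀ η²` (so that `μ² e^{2κ(x−x_e)} = ℓ(ℓ+1) w₀ e^{(x−x_c)/2M}`
EXACTLY), the packet

  `ψ(t,x) = χ(e^{κ(x−x_e)} cosh κt) · sin(μ κ⁻¹ e^{κ(x−x_e)} sinh κt)`,  `χ ∈ C²`, `χ = 0` off `(13/20, 17/20)`,

is compared with ANY global `C²` Regge–Wheeler solution `φ` (`IsSolution (linePotential M 1 ℓ r) φ`):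

* `restPacket_defect_bound` — the defect of `w = φ − ψ` is uniformly small:
  `|w_tt − w_xx + V w| ≤ 2e^{1/2} B₀ μ²η² + κ² B₂` (`|χ| ≤ B₀`, `|χ''| ≤ B₂`), on the whole plane,
  as soon as the near edge lies on the horizon-side half-line of the mass asymptotics;
* `restPacket_eq_zero_of_le`, `restPacket_eq_zero_of_ge` — `ψ = 0` for `x ≥ x_e` and, for
  `|t| ≤ T₁`, for `x ≤ x_e + κ⁻¹(log(13/20) − log cosh(κT₁))` (compact spatial support on slabs);
* `restPacket_eventuallyEq_zero_exterior` — at `|t| = κ⁻¹` the packet vanishes NEAR every point of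
  the exterior region `{ρ + |t| < |x − x_c|}` (since `e⁻¹ cosh 1 < 13/20`), so there
  `energyDensity V φ = energyDensity V (φ − ψ)` (`energyDensity_sub_eq_of_eventuallyEq_zero`);
* data bookkeeping: `w` has zero Cauchy data when `φ` has the packet's data
  (`restPacket_sub_data`), and the packet's velocity datum `g = μ e^{κ(x−x_e)} χ(e^{κ(x−x_e)})` has
  `∫_α^β g² = μ² ∫_{α₀}^{β₀} (e^{κz} χ(e^{κz}))² dz` (`integral_velocity_sq`).

This is the analytic content of the rest-packet refutation of the uniform photon-sphere channel
inequality (route `PhotonSphereChannels`, Final State Conjecture, item `UniformPhotonSphereChannels`);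
the parameters enter only through the displayed combinations, so every constant is `ℓ`- and
`ρ`-independent except through `μ²η²`.

## References

* N. D. Birrell, P. C. W. Davies, *Quantum Fields in Curved Space*, CUP (1982), §4.5
  (key `BirrellDavies1982`).
* M. Dafermos, I. Rodnianski, arXiv:0811.0354, App. F.2 (key `DafermosRodnianski2008`).
-/

noncomputable section

open _root_.Real _root_.Set _root_.Filter _root_.MeasureTheory intervalIntegral
open scoped _root_.Topology

namespace Literature.Geometry.Lorentzian

namespace ReggeWheeler

open Literature.Analysis.PDE

/-! ### Calculus helpers -/

/-- A function vanishing on an open set has vanishing first and second derivatives there.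
[folklore] -/
theorem deriv_deriv_eq_zero_of_eqOn_zero {χ : ℝ → ℝ} {S : Set ℝ} (hS : IsOpen S)
    (h : ∀ u ∈ S, χ u = 0) {u : ℝ} (hu : u ∈ S) : deriv χ u = 0 ∧ deriv (deriv χ) u = 0 := by
  have h1 : ∀ v ∈ S, deriv χ v = 0 := fun v hv => by
    have hev : χ =ᶠ[𝓝 v] fun _ => (0 : ℝ) := by
      filter_upwards [hS.mem_nhds hv] with w hw using h w hw
    rw [hev.deriv_eq, deriv_const]
  refine ⟨h1 u hu, ?_⟩
  have hev : deriv χ =ᶠ[𝓝 u] fun _ => (0 : ℝ) := by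
    filter_upwards [hS.mem_nhds hu] with w hw using h1 w hw
  rw [hev.deriv_eq, deriv_const]

/-- The energy density of `φ − ψ` equals that of `φ` at a point near which `ψ` vanishes
(no differentiability is needed: derivatives of eventually equal slices agree). [folklore] -/
theorem energyDensity_sub_eq_of_eventuallyEq_zero {V : ℝ → ℝ} {φ ψ : ℝ → ℝ → ℝ} {t x : ℝ}
    (h : Function.uncurry ψ =ᶠ[𝓝 (t, x)] fun _ => 0) :
    energyDensity V (fun s y => φ s y - ψ s y) t x = energyDensity V φ t x := by
  -- the two slices of `ψ` through `(t, x)` vanish near `t`, resp. near `x`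
  have ht : (fun τ => ψ τ x) =ᶠ[𝓝 t] fun _ => (0 : ℝ) := by
    have hc : ContinuousAt (fun τ : ℝ => (τ, x)) t := (continuous_id.prodMk continuous_const).continuousAt
    exact hc.eventually h
  have hx : (fun y => ψ t y) =ᶠ[𝓝 x] fun _ => (0 : ℝ) := by
    have hc : ContinuousAt (fun y : ℝ => (t, y)) x := (continuous_const.prodMk continuous_id).continuousAt
    exact hc.eventually h
  have h1 : (fun τ => φ τ x - ψ τ x) =ᶠ[𝓝 t] fun τ => φ τ x := by
    filter_upwards [ht] with τ hτ
    simp [hτ]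
  have h2 : (fun y => φ t y - ψ t y) =ᶠ[𝓝 x] fun y => φ t y := by
    filter_upwards [hx] with y hy
    simp [hy]
  have h0 : ψ t x = 0 := by
    have := ht.self_of_nhds
    simpa using this
  unfold energyDensity
  beta_reduce
  rw [h1.deriv_eq, h2.deriv_eq, h0, sub_zero]

/-! ### The rest packet against the Regge–Wheeler potential -/

section Packet

variable {M : ℝ} {r : ℝ → ℝ} {xc : ℝ} {ℓ : ℕ} {ρ κ xe η μ : ℝ} {χ : ℝ → ℝ} {ψ φ : ℝ → ℝ → ℝ}

/-- Where the cut-off is alive the packet sits strictly below the near edge: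
`χ(e^{κ(x−x_e)} cosh κt) ≠ 0 ⇒ e^{κ(x−x_e)} < 17/20` (`χ = 0` off `(13/20, 17/20)`). [folklore] -/
theorem exp_lt_of_cutoff_ne_zero (hχ0 : ∀ u, u ≤ 13 / 20 ∨ 17 / 20 ≤ u → χ u = 0) {t x : ℝ}
    (h : χ (Real.exp (κ * (x - xe)) * Real.cosh (κ * t)) ≠ 0) :
    Real.exp (κ * (x - xe)) < 17 / 20 := by
  by_contra hcon
  push Not at hcon
  apply h
  apply hχ0
  right
  calc (17 : ℝ) / 20 ≤ Real.exp (κ * (x - xe)) := hcon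
    _ = Real.exp (κ * (x - xe)) * 1 := (mul_one _).symm
    _ ≤ Real.exp (κ * (x - xe)) * Real.cosh (κ * t) :=
        mul_le_mul_of_nonneg_left (Real.one_le_cosh _) (Real.exp_pos _).le

/-- The packet vanishes from the near edge on: `x_e ≤ x ⇒ ψ(t, x) = 0` (`κ ≥ 0`). [folklore] -/
theorem restPacket_eq_zero_of_ge (hκ : 0 ≤ κ) (hχ0 : ∀ u, u ≤ 13 / 20 ∨ 17 / 20 ≤ u → χ u = 0)
    (hψ : ∀ t x, ψ t x = χ (Real.exp (κ * (x - xe)) * Real.cosh (κ * t))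
      * Real.sin (μ / κ * Real.exp (κ * (x - xe)) * Real.sinh (κ * t))) {t x : ℝ} (hx : xe ≤ x) :
    ψ t x = 0 := by
  refine rindlerPacket_eq_zero hχ0 hψ (Or.inr ?_)
  have h1 : 1 ≤ Real.exp (κ * (x - xe)) := Real.one_le_exp (mul_nonneg hκ (by linarith))
  calc (17 : ℝ) / 20 ≤ 1 * 1 := by norm_num
    _ ≤ Real.exp (κ * (x - xe)) * Real.cosh (κ * t) :=
        mul_le_mul h1 (Real.one_le_cosh _) zero_le_one (Real.exp_pos _).le

/-- The packet vanishes deep on the horizon side, uniformly on time slabs: for `|t| ≤ T₁` and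
`x ≤ x_e + κ⁻¹(log(13/20) − log cosh(κ T₁))`, `ψ(t, x) = 0` (`κ > 0`). [folklore] -/
theorem restPacket_eq_zero_of_le (hκ : 0 < κ) (hχ0 : ∀ u, u ≤ 13 / 20 ∨ 17 / 20 ≤ u → χ u = 0)
    (hψ : ∀ t x, ψ t x = χ (Real.exp (κ * (x - xe)) * Real.cosh (κ * t))
      * Real.sin (μ / κ * Real.exp (κ * (x - xe)) * Real.sinh (κ * t))) {T₁ t x : ℝ}
    (ht : |t| ≤ T₁) (hx : x ≤ xe + κ⁻¹ * (Real.log (13 / 20) - Real.log (Real.cosh (κ * T₁)))) :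
    ψ t x = 0 := by
  refine rindlerPacket_eq_zero hχ0 hψ (Or.inl ?_)
  have hC : 0 < Real.cosh (κ * T₁) := Real.cosh_pos _
  have hct : Real.cosh (κ * t) ≤ Real.cosh (κ * T₁) := by
    rw [Real.cosh_le_cosh, abs_mul, abs_of_pos hκ, abs_mul, abs_of_pos hκ]
    have : |T₁| = T₁ := abs_of_nonneg ((abs_nonneg t).trans ht)
    rw [this]
    exact mul_le_mul_of_nonneg_left ht hκ.le
  have hE : Real.exp (κ * (x - xe)) ≤ (13 / 20) / Real.cosh (κ * T₁) := by
    have h1 : κ * (x - xe) ≤ Real.log (13 / 20) - Real.log (Real.cosh (κ * T₁)) := by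
      have := mul_le_mul_of_nonneg_left (sub_nonneg.2 hx |>.trans_eq (by ring) : 0 ≤ xe + κ⁻¹ *
        (Real.log (13 / 20) - Real.log (Real.cosh (κ * T₁))) - x) hκ.le
      have hk : κ * (κ⁻¹ * (Real.log (13 / 20) - Real.log (Real.cosh (κ * T₁))))
          = Real.log (13 / 20) - Real.log (Real.cosh (κ * T₁)) := by
        rw [← mul_assoc, mul_inv_cancel₀ hκ.ne', one_mul]
      nlinarith
    calc Real.exp (κ * (x - xe)) ≤ Real.exp (Real.log (13 / 20) - Real.log (Real.cosh (κ * T₁))) :=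
          Real.exp_le_exp.2 h1
      _ = (13 / 20) / Real.cosh (κ * T₁) := by
          rw [Real.exp_sub, Real.exp_log (by norm_num), Real.exp_log hC]
  calc Real.exp (κ * (x - xe)) * Real.cosh (κ * t)
      ≤ (13 / 20) / Real.cosh (κ * T₁) * Real.cosh (κ * T₁) :=
        mul_le_mul hE hct (Real.cosh_pos _).le (by positivity)
    _ = 13 / 20 := by field_simp

/-- `e⁻¹ cosh 1 = (1 + e⁻²)/2 < 13/20` (the number behind "the packet is inside the channel at
`t = κ⁻¹`", i.e. the lag law `4M ln 2 > ` the packet depth). [folklore] -/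
theorem exp_neg_one_mul_cosh_one_lt : Real.exp (-1) * Real.cosh 1 < 13 / 20 := by
  rw [Real.cosh_eq]
  have he : (27 : ℝ) / 10 < Real.exp 1 := lt_trans (by norm_num) Real.exp_one_gt_d9
  have he0 : 0 < Real.exp 1 := Real.exp_pos 1
  have h1 : Real.exp (-1) * ((Real.exp 1 + Real.exp (-1)) / 2) = (1 + (Real.exp 1)⁻¹ ^ 2) / 2 := by
    rw [Real.exp_neg]
    field_simp
  rw [h1]
  have h2 : (Real.exp 1)⁻¹ < 10 / 27 := by
    rw [inv_lt_comm₀ he0 (by norm_num)]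
    simpa using he
  have h3 : 0 < (Real.exp 1)⁻¹ := inv_pos.2 he0
  nlinarith

/-- **At `|t| = κ⁻¹` the packet vanishes near every point of the exterior region**
`{ρ + |t| < |x − x_c|}` (`ρ ≥ 0`, `x_e = x_c − ρ`, `κ > 0`): `uncurry ψ` is eventually zero there.
[folklore] -/
theorem restPacket_eventuallyEq_zero_exterior (hκ : 0 < κ) (hρ : 0 ≤ ρ) (hxe : xe = xc - ρ)
    (hχ0 : ∀ u, u ≤ 13 / 20 ∨ 17 / 20 ≤ u → χ u = 0)
    (hψ : ∀ t x, ψ t x = χ (Real.exp (κ * (x - xe)) * Real.cosh (κ * t))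
      * Real.sin (μ / κ * Real.exp (κ * (x - xe)) * Real.sinh (κ * t))) {t x : ℝ}
    (ht : |t| = κ⁻¹) (hx : ρ + |t| < |x - xc|) :
    Function.uncurry ψ =ᶠ[𝓝 (t, x)] fun _ => 0 := by
  rw [lt_abs] at hx
  rcases hx with hx | hx
  · -- far side: `x > x_e`, the packet vanishes on the open set `{y > x_e}`
    have hxe' : xe < x := by rw [hxe]; linarith [abs_nonneg t]
    have hopen : IsOpen {p : ℝ × ℝ | xe < p.2} := isOpen_lt continuous_const continuous_snd
    filter_upwards [hopen.mem_nhds (show (t, x) ∈ {p : ℝ × ℝ | xe < p.2} from hxe')] with p hp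
    exact restPacket_eq_zero_of_ge hκ.le hχ0 hψ (le_of_lt hp)
  · -- near side: `x < x_e − κ⁻¹`, the Rindler position is `< e⁻¹ cosh 1 < 13/20`
    have hxe' : x - xe < -κ⁻¹ := by rw [hxe]; linarith
    have hlt : Real.exp (κ * (x - xe)) * Real.cosh (κ * t) < 13 / 20 := by
      have h1 : Real.exp (κ * (x - xe)) < Real.exp (-1) := by
        rw [Real.exp_lt_exp]
        have := mul_lt_mul_of_pos_left hxe' hκ
        rwa [mul_neg, mul_inv_cancel₀ hκ.ne'] at this
      have h2 : Real.cosh (κ * t) = Real.cosh 1 := by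
        rw [← Real.cosh_abs, abs_mul, abs_of_pos hκ, ht, mul_inv_cancel₀ hκ.ne']
      rw [h2]
      calc Real.exp (κ * (x - xe)) * Real.cosh 1 < Real.exp (-1) * Real.cosh 1 :=
            mul_lt_mul_of_pos_right h1 (Real.cosh_pos _)
        _ < 13 / 20 := exp_neg_one_mul_cosh_one_lt
    have hopen := isOpen_rindlerPosition_lt κ xe (13 / 20)
    filter_upwards [hopen.mem_nhds (show (t, x) ∈ _ from hlt)] with p hp
    exact rindlerPacket_eq_zero hχ0 hψ (Or.inl (le_of_lt hp))

/-- **The defect of `φ − ψ` is uniformly small.**  Let `κ = 1/4M`, `x_e = x_c − ρ`,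
`η = e^{κ(x_e−x_c)}`, `μ² = ℓ(ℓ+1) w₀ η²` (`w₀ = e^{1/2}/8M²`), `χ ∈ C²` vanishing off `(13/20, 17/20)`
with `|χ| ≤ B₀`, `|χ''| ≤ B₂`, and suppose the horizon expansion of `V = V_{1,ℓ}∘r` holds for
`x ≤ x₀` with `x_e ≤ x₀`.  Then for every global `C²` solution `φ` of `φ_tt − φ_xx + Vφ = 0` and all
`(t, x)`: `|w_tt − w_xx + V w| ≤ 2e^{1/2} B₀ μ²η² + κ² B₂`, `w = φ − ψ`.
[cite: BirrellDavies1982, §4.5] -/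
theorem restPacket_defect_bound (hr : IsTortoiseRadius M r xc) (hκ : κ = 1 / (4 * M))
    (hη : η = Real.exp (κ * (xe - xc)))
    (hμ : μ ^ 2 = (ℓ : ℝ) * ((ℓ : ℝ) + 1) * (Real.exp (1 / 2) / (8 * M ^ 2)) * η ^ 2)
    {x₀ : ℝ} (hx₀ : ∀ x ≤ x₀, |linePotential M 1 ℓ r x
        - (ℓ : ℝ) * ((ℓ : ℝ) + 1) * (Real.exp (1 / 2) / (8 * M ^ 2)) * Real.exp ((x - xc) / (2 * M))|
      ≤ 2 * Real.exp (1 / 2) * (Real.exp (1 / 2) / (8 * M ^ 2)) * ((ℓ : ℝ) * ((ℓ : ℝ) + 1))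
          * Real.exp ((x - xc) / M))
    (hxe₀ : xe ≤ x₀) (hχ : ContDiff ℝ 2 χ) (hχ0 : ∀ u, u ≤ 13 / 20 ∨ 17 / 20 ≤ u → χ u = 0)
    {B₀ B₂ : ℝ} (hB₀ : ∀ u, |χ u| ≤ B₀) (hB₂ : ∀ u, |deriv (deriv χ) u| ≤ B₂)
    (hψ : ∀ t x, ψ t x = χ (Real.exp (κ * (x - xe)) * Real.cosh (κ * t))
      * Real.sin (μ / κ * Real.exp (κ * (x - xe)) * Real.sinh (κ * t)))
    (hφ : IsSolution (linePotential M 1 ℓ r) φ) (t x : ℝ) :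
    |iteratedDeriv 2 (fun τ => φ τ x - ψ τ x) t - iteratedDeriv 2 (fun y => φ t y - ψ t y) x
        + linePotential M 1 ℓ r x * (φ t x - ψ t x)|
      ≤ 2 * Real.exp (1 / 2) * B₀ * μ ^ 2 * η ^ 2 + κ ^ 2 * B₂ := by
  have hM := hr.mass_pos
  have hκ0 : 0 < κ := by rw [hκ]; positivity
  have hB₀0 : 0 ≤ B₀ := (abs_nonneg _).trans (hB₀ 0)
  have hB₂0 : 0 ≤ B₂ := (abs_nonneg _).trans (hB₂ 0)
  set V := linePotential M 1 ℓ r with hV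
  set E := Real.exp (κ * (x - xe)) with hE
  set u := E * Real.cosh (κ * t) with hu
  set θ := μ / κ * E * Real.sinh (κ * t) with hθ
  have hE0 : 0 < E := Real.exp_pos _
  -- slices are `C²`
  have hψ2 : ContDiff ℝ 2 (Function.uncurry ψ) := rindlerPacket_contDiff hχ hψ
  have hφt : ContDiffAt ℝ 2 (fun τ => φ τ x) t :=
    (hφ.1.comp (contDiff_id.prodMk contDiff_const)).contDiffAt
  have hψt : ContDiffAt ℝ 2 (fun τ => ψ τ x) t :=
    (hψ2.comp (contDiff_id.prodMk contDiff_const)).contDiffAt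
  have hφx : ContDiffAt ℝ 2 (fun y => φ t y) x :=
    (hφ.1.comp (contDiff_const.prodMk contDiff_id)).contDiffAt
  have hψx : ContDiffAt ℝ 2 (fun y => ψ t y) x :=
    (hψ2.comp (contDiff_const.prodMk contDiff_id)).contDiffAt
  rw [iteratedDeriv_fun_sub hφt hψt, iteratedDeriv_fun_sub hφx hψx]
  -- the equation for `φ` and the packet identity for `ψ`
  have hsol : iteratedDeriv 2 (fun τ => φ τ x) t - iteratedDeriv 2 (fun y => φ t y) x + V x * φ t x = 0 :=
    hφ.2 (t, x)
  have hwave := rindlerPacket_wave hχ hκ0.ne' hψ t x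
  have hψval : ψ t x = χ u * Real.sin θ := by rw [hψ]
  -- the defect is `[(E²μ² − V) χ(u) + κ²E² χ''(u)] sin θ`
  have hdef : iteratedDeriv 2 (fun τ => φ τ x) t - iteratedDeriv 2 (fun τ => ψ τ x) t
      - (iteratedDeriv 2 (fun y => φ t y) x - iteratedDeriv 2 (ψ t) x) + V x * (φ t x - ψ t x)
      = ((E ^ 2 * μ ^ 2 - V x) * χ u + κ ^ 2 * E ^ 2 * deriv (deriv χ) u) * Real.sin θ := by
    have : iteratedDeriv 2 (fun τ => ψ τ x) t - iteratedDeriv 2 (ψ t) x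
        = -(E ^ 2 * (μ ^ 2 * χ u + κ ^ 2 * deriv (deriv χ) u) * Real.sin θ) := hwave
    rw [hψval]
    linear_combination hsol - this
  have hfun : (fun y => φ t y) = φ t := rfl
  rw [hfun] at *
  rw [show (fun y => ψ t y) = ψ t from rfl] at *
  rw [hdef]
  -- bound the two terms
  have hsin : |Real.sin θ| ≤ 1 := Real.abs_sin_le_one θ
  have hterm2 : |κ ^ 2 * E ^ 2 * deriv (deriv χ) u| ≤ κ ^ 2 * B₂ := by
    rcases le_or_gt x xe with hx | hx
    · have hE1 : E ≤ 1 := by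
        rw [hE]; exact Real.exp_le_one_iff.2 (mul_nonpos_of_nonneg_of_nonpos hκ0.le (by linarith))
      rw [abs_mul, abs_mul, abs_of_nonneg (sq_nonneg κ), abs_of_nonneg (sq_nonneg E)]
      calc κ ^ 2 * E ^ 2 * |deriv (deriv χ) u| ≤ κ ^ 2 * 1 * B₂ := by
            gcongr
            · nlinarith
            · exact hB₂ u
        _ = κ ^ 2 * B₂ := by ring
    · -- `x > x_e`: `u > 1 > 17/20`, so `χ'' u = 0`
      have hu1 : (17 : ℝ) / 20 < u := by
        have hE1 : 1 < E := by
          rw [hE]; exact Real.one_lt_exp_iff.2 (mul_pos hκ0 (by linarith))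
        calc (17 : ℝ) / 20 < 1 * 1 := by norm_num
          _ ≤ E * Real.cosh (κ * t) := mul_le_mul hE1.le (Real.one_le_cosh _) zero_le_one hE0.le
      have hz := (deriv_deriv_eq_zero_of_eqOn_zero isOpen_Ioi
        (fun v hv => hχ0 v (Or.inr (le_of_lt hv))) hu1).2
      rw [hz, mul_zero, abs_zero]
      positivity
  have hterm1 : |(E ^ 2 * μ ^ 2 - V x) * χ u| ≤ 2 * Real.exp (1 / 2) * B₀ * μ ^ 2 * η ^ 2 := by
    by_cases hχu : χ u = 0
    · rw [hχu, mul_zero, abs_zero]; positivity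
    · -- the cut-off is alive: `E < 17/20 < 1`, so `x < x_e ≤ x₀` and the expansion applies
      have hElt : E < 17 / 20 := exp_lt_of_cutoff_ne_zero hχ0 hχu
      have hE1 : E ≤ 1 := by linarith
      have hxlt : x ≤ x₀ := by
        have : x - xe < 0 := by
          by_contra hcon
          push Not at hcon
          have : 1 ≤ E := by rw [hE]; exact Real.one_le_exp (mul_nonneg hκ0.le hcon)
          linarith
        linarith
      have hexp1 : Real.exp ((x - xc) / (2 * M)) = E ^ 2 * η ^ 2 := by
        rw [hE, hη, ← Real.exp_nat_mul, ← Real.exp_nat_mul, ← Real.exp_add]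
        congr 1
        rw [hκ]; push_cast; field_simp; ring
      have hexp2 : Real.exp ((x - xc) / M) = E ^ 4 * η ^ 4 := by
        rw [hE, hη, ← Real.exp_nat_mul, ← Real.exp_nat_mul, ← Real.exp_add]
        congr 1
        rw [hκ]; push_cast; field_simp; ring
      have hmass := hx₀ x hxlt
      rw [hexp1, hexp2] at hmass
      -- rewrite in terms of `μ²`
      have hVdiff : |E ^ 2 * μ ^ 2 - V x| ≤ 2 * Real.exp (1 / 2) * μ ^ 2 * η ^ 2 * E ^ 4 := by
        have h1 : (ℓ : ℝ) * ((ℓ : ℝ) + 1) * (Real.exp (1 / 2) / (8 * M ^ 2)) * (E ^ 2 * η ^ 2)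
            = E ^ 2 * μ ^ 2 := by rw [hμ]; ring
        have h2 : 2 * Real.exp (1 / 2) * (Real.exp (1 / 2) / (8 * M ^ 2)) * ((ℓ : ℝ) * ((ℓ : ℝ) + 1))
            * (E ^ 4 * η ^ 4) = 2 * Real.exp (1 / 2) * μ ^ 2 * η ^ 2 * E ^ 4 := by rw [hμ]; ring
        rw [h1, h2] at hmass
        rwa [abs_sub_comm] at hmass
      have hE4 : E ^ 4 ≤ 1 := pow_le_one₀ hE0.le hE1
      have hμη : 0 ≤ 2 * Real.exp (1 / 2) * μ ^ 2 * η ^ 2 := by positivity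
      rw [abs_mul]
      calc |E ^ 2 * μ ^ 2 - V x| * |χ u| ≤ (2 * Real.exp (1 / 2) * μ ^ 2 * η ^ 2 * E ^ 4) * B₀ :=
            mul_le_mul hVdiff (hB₀ u) (abs_nonneg _) (by positivity)
        _ ≤ (2 * Real.exp (1 / 2) * μ ^ 2 * η ^ 2 * 1) * B₀ := by gcongr
        _ = 2 * Real.exp (1 / 2) * B₀ * μ ^ 2 * η ^ 2 := by ring
  calc |((E ^ 2 * μ ^ 2 - V x) * χ u + κ ^ 2 * E ^ 2 * deriv (deriv χ) u) * Real.sin θ|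
      = |(E ^ 2 * μ ^ 2 - V x) * χ u + κ ^ 2 * E ^ 2 * deriv (deriv χ) u| * |Real.sin θ| := abs_mul _ _
    _ ≤ |(E ^ 2 * μ ^ 2 - V x) * χ u + κ ^ 2 * E ^ 2 * deriv (deriv χ) u| * 1 :=
        mul_le_mul_of_nonneg_left hsin (abs_nonneg _)
    _ ≤ (2 * Real.exp (1 / 2) * B₀ * μ ^ 2 * η ^ 2 + κ ^ 2 * B₂) * 1 := by
        gcongr
        exact (abs_add_le _ _).trans (add_le_add hterm1 hterm2)
    _ = 2 * Real.exp (1 / 2) * B₀ * μ ^ 2 * η ^ 2 + κ ^ 2 * B₂ := mul_one _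

/-- **Zero Cauchy data of the difference.** If `φ` carries the packet's Cauchy data
`(0, μ e^{κ(x−x_e)} χ(e^{κ(x−x_e)}))` then `w = φ − ψ` has zero data (`κ ≠ 0`, `χ ∈ C²`,
`φ ∈ C²`). [folklore] -/
theorem restPacket_sub_data (hκ : κ ≠ 0) (hχ : ContDiff ℝ 2 χ)
    (hψ : ∀ t x, ψ t x = χ (Real.exp (κ * (x - xe)) * Real.cosh (κ * t))
      * Real.sin (μ / κ * Real.exp (κ * (x - xe)) * Real.sinh (κ * t)))
    (hφ : ContDiff ℝ 2 (Function.uncurry φ)) (h0 : ∀ x, φ 0 x = 0)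
    (h1 : ∀ x, deriv (fun τ => φ τ x) 0 = μ * Real.exp (κ * (x - xe)) * χ (Real.exp (κ * (x - xe)))) :
    (∀ x, φ 0 x - ψ 0 x = 0) ∧ (∀ x, deriv (fun τ => φ τ x - ψ τ x) 0 = 0) := by
  refine ⟨fun x => by rw [h0, rindlerPacket_zero hψ, sub_zero], fun x => ?_⟩
  have hdφ : DifferentiableAt ℝ (fun τ => φ τ x) 0 :=
    ((hφ.comp (contDiff_id.prodMk contDiff_const)).differentiable (by norm_num)) 0
  have hdψ : DifferentiableAt ℝ (fun τ => ψ τ x) 0 :=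
    (hasDerivAt_rindlerPacket_time hχ hψ 0 x).differentiableAt
  rw [deriv_fun_sub hdφ hdψ, h1, rindlerPacket_deriv_zero hχ hκ hψ, sub_self]

/-- **The velocity datum's `L²` mass scales like `μ²`**: with `g(x) = μ e^{κ(x−x_e)} χ(e^{κ(x−x_e)})`,
`∫_{x_e+a}^{x_e+b} g² = μ² ∫_a^b (e^{κz} χ(e^{κz}))² dz`. [folklore] -/
theorem integral_velocity_sq (μ κ xe a b : ℝ) (χ : ℝ → ℝ) :
    ∫ x in (xe + a)..(xe + b), (μ * Real.exp (κ * (x - xe)) * χ (Real.exp (κ * (x - xe)))) ^ 2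
      = μ ^ 2 * ∫ z in a..b, (Real.exp (κ * z) * χ (Real.exp (κ * z))) ^ 2 := by
  have h := intervalIntegral.integral_comp_sub_right
    (fun z => (μ * Real.exp (κ * z) * χ (Real.exp (κ * z))) ^ 2) (a := xe + a) (b := xe + b) xe
  simp only [add_sub_cancel_left] at h
  rw [h, ← intervalIntegral.integral_const_mul]
  refine intervalIntegral.integral_congr fun z _ => ?_
  ring

end Packet

end ReggeWheeler

end Literature.Geometry.Lorentzian

end
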